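import Summits.ValiantsHypothesis.ValiantsHypothesis.Theorems.SymPencilSingFiveClassificationDefs
import Summits.ValiantsHypothesis.ValiantsHypothesis.Theorems.SymPencilPerFourCrossPairNoJoint
import Summits.ValiantsHypothesis.ValiantsHypothesis.Theorems.SymPencilPerFourRowPairNoJoint
import Summits.ValiantsHypothesis.ValiantsHypothesis.Theorems.SymPencilPerFourRowPairSkewNoJoint
import Summits.ValiantsHypothesis.ValiantsHypothesis.Theorems.SymPencilPerFourRowPairSumNoJoint
import Summits.ValiantsHypothesis.ValiantsHypothesis.Theorems.SymPencilPerFourJointFamilyTransport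

/-!
# Route `SymPencil` — the V-side of the size-27 cell `(11, 5, 4)`, PORT of val-idea-18's cascade: brick dispatch
# (`--supports` stmt-ValiantsHypothesis-5674 `SdcSuperquadratic`; verbatim port of §3 of
# `Cruxes/SdcSuperquadratic/Lines/sing_five_classification.lean` rev 10 (val-idea-18 g5); PORT-PLAN-115.md; rung currency only)

The JOINT-family bricks ✓ `SymPencilPerFourCrossPairNoJoint` (p605739), ✓ `…RowPairNoJoint` (p605861), ✓ `…RowPairSkewNoJoint` (p606014),
✓ `…RowPairSumNoJoint` (p606066) and the transport ✓ `…JointFamilyTransport` (p606263), dispatched over the normal forms of the leaves: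
`exists_perm_zero_three`, `funCongrLeft_prodCongr_symm_apply`, `noJoint_of_vFiveCrossType` (leaf X's output carries no joint family),
`noJoint_of_rowNormal`, `torusDispatch_perm`, `torusDispatch` (= the workfile's `stub_torusDispatch`: torus type ⇒ no joint family).

Honest framing: [folklore] a verbatim port; `27 ≤ sdc(per₄) ≤ 29` unchanged; the crux `SdcSuperquadratic` and `VP ≠ VNP` untouched; no summit
statement is proved here.  No definitions, no named facts.
-/

noncomputable section

-- single-conjunct layout: Sub = Summit, duplicated namespace component intended
set_option linter.dupNamespace false

namespace Summit.ValiantsHypothesis.ValiantsHypothesis.Theorems.SymPencilSingFiveClassification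

open MvPolynomial Module Matrix
open scoped Polynomial
open Literature.Computability.AlgebraicComplexity
open Summit.ValiantsHypothesis.ValiantsHypothesis.Theorems
open Summit.ValiantsHypothesis.ValiantsHypothesis.Theorems.SymPencilSingSixClassification
open Summit.ValiantsHypothesis.ValiantsHypothesis.Theorems.SymPencilPerFourJointFamilyTransport

variable {K : Type*} [Field K]

/-- Two-point transitivity of `S₄` used to normalise a cross. [folklore] -/
theorem exists_perm_zero_three : ∀ l b : Fin 4, b ≠ l →
    ∃ σ : Equiv.Perm (Fin 4), σ 0 = l ∧ σ 3 = b := by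
  decide

/-- The coordinate description of the inverse of a `prodCongr` relabelling. [folklore] -/
theorem funCongrLeft_prodCongr_symm_apply (σ τ : Equiv.Perm (Fin 4)) (y : Fin 4 × Fin 4 → K)
    (i j : Fin 4) :
    (LinearEquiv.funCongrLeft K K (Equiv.prodCongr σ τ)).symm y (i, j) = y (σ.symm i, τ.symm j) := by
  rfl

/-- **`V₅×`-type carries no joint family of four squares**: transport to `l = c = 0`, removed cells
`(0,3)`, `(3,0)`, where `E₁₀ + E₀₂` and `E₂₀ + E₀₁` lie in the space, and ✓ … (memo). [folklore] -/
theorem noJoint_of_vFiveCrossType [CharZero K] {W : Submodule K (Fin 4 × Fin 4 → K)}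
    (h : VFiveCrossType W) : ¬ HasJointFour W := by
  classical
  rintro ⟨cc, β, hJ⟩
  obtain ⟨l, c, a, b, hac, hbl, hiff⟩ := h
  obtain ⟨σ, hσ0, hσ3⟩ := exists_perm_zero_three l b hbl
  obtain ⟨τ, hτ0, hτ3⟩ := exists_perm_zero_three c a hac
  let Φ : (Fin 4 × Fin 4 → K) ≃ₗ[K] (Fin 4 × Fin 4 → K) :=
    LinearEquiv.funCongrLeft K K (Equiv.prodCongr σ τ)
  have hΦ : ∀ z, eval (Φ z) (perPoly (Fin 4) K) = 1 * eval z (perPoly (Fin 4) K) := fun z => by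
    rw [one_mul]; exact SymPencilPerFourBlocks.eval_perPoly_comp_prodCongr σ τ z
  have hσl : σ.symm l = 0 := by rw [← hσ0, Equiv.symm_apply_apply]
  have hσb : σ.symm b = 3 := by rw [← hσ3, Equiv.symm_apply_apply]
  have hτc : τ.symm c = 0 := by rw [← hτ0, Equiv.symm_apply_apply]
  have hτa : τ.symm a = 3 := by rw [← hτ3, Equiv.symm_apply_apply]
  have hmem : ∀ (y : Fin 4 × Fin 4 → K),
      (∀ i j : Fin 4, i ≠ 0 → j ≠ 0 → y (i, j) = 0) → y (0, 3) = 0 → y (3, 0) = 0 →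
      y ∈ W.map Φ.toLinearMap := by
    intro y hy h03 h30
    rw [show Φ.toLinearMap = (Φ : (Fin 4 × Fin 4 → K) →ₗ[K] (Fin 4 × Fin 4 → K)) from rfl,
      Submodule.mem_map_equiv, hiff]
    refine ⟨fun i j hi hj => ?_, ?_, ?_⟩
    · rw [funCongrLeft_prodCongr_symm_apply]
      apply hy
      · intro h0; apply hi
        have := congrArg σ h0; rwa [Equiv.apply_symm_apply, hσ0] at this
      · intro h0; apply hj
        have := congrArg τ h0; rwa [Equiv.apply_symm_apply, hτ0] at this
    · rw [funCongrLeft_prodCongr_symm_apply, hσl, hτa]; exact h03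
    · rw [funCongrLeft_prodCongr_symm_apply, hσb, hτc]; exact h30
  have h₀ : (fun p : Fin 4 × Fin 4 => if p = (1, 0) then (1 : K) else if p = (0, 2) then 1 else 0) ∈
      W.map Φ.toLinearMap := by
    apply hmem
    · intro i j hi hj
      have h1 : ((i, j) : Fin 4 × Fin 4) ≠ (1, 0) := fun h => hj (Prod.mk.inj h).2
      have h2 : ((i, j) : Fin 4 × Fin 4) ≠ (0, 2) := fun h => hi (Prod.mk.inj h).1
      simp [h1, h2]
    · simp
    · simp
  have h₁ : (fun p : Fin 4 × Fin 4 => if p = (2, 0) then (1 : K) else if p = (0, 1) then 1 else 0) ∈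
      W.map Φ.toLinearMap := by
    apply hmem
    · intro i j hi hj
      have h1 : ((i, j) : Fin 4 × Fin 4) ≠ (2, 0) := fun h => hj (Prod.mk.inj h).2
      have h2 : ((i, j) : Fin 4 × Fin 4) ≠ (0, 1) := fun h => hi (Prod.mk.inj h).1
      simp [h1, h2]
    · simp
    · simp
  exact not_jointFamily_of_map W Φ 1 hΦ
    (fun c' β' => SymPencilPerFourCrossPairNoJoint.not_jointFamily_four_of_cross_pair _ h₀ h₁ c' β')
    cc β hJ

set_option linter.unusedSimpArgs false in
/-- **Torus + brick step.**  A space that contains every matrix supported on rows `0,1` and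
columns `0,1,2` whose row `1` is annihilated by the weight vector `θ`, with support … (memo). [folklore] -/
theorem noJoint_of_rowNormal [CharZero K] (V : Submodule K (Fin 4 × Fin 4 → K)) (θ : Fin 4 → K)
    (hV : ∀ y : Fin 4 × Fin 4 → K, (∀ j, y (2, j) = 0) → (∀ j, y (3, j) = 0) → y (0, 3) = 0 →
      y (1, 3) = 0 → ∑ j, θ j * y (1, j) = 0 → y ∈ V)
    (hS : (θ 0 = 0 ∧ θ 1 = 0 ∧ θ 2 ≠ 0) ∨ (θ 0 ≠ 0 ∧ θ 1 ≠ 0 ∧ θ 2 = 0) ∨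
      (θ 0 ≠ 0 ∧ θ 1 ≠ 0 ∧ θ 2 ≠ 0))
    (c : Fin 4 → K) (β : Fin 4 → ((Fin 4 × Fin 4 → K) →ₗ[K] (Fin 4 × Fin 4 → K) →ₗ[K] K)) :
    ¬ (∀ u : Fin 4 × Fin 4 → K, ∀ y ∈ V, ∃ e₀ e₁ : K, ∀ s : K,
        eval (u + s • y) (perPoly (Fin 4) K) = e₀ + s * e₁ + s ^ 2 * ∑ k, c k * (β k u y) ^ 2) := by
  classical
  intro hJ
  set c' : Fin 4 → K := fun j => if θ j = 0 then 1 else θ j with hc'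
  have hc'ne : ∀ j, c' j ≠ 0 := fun j => by
    by_cases h : θ j = 0 <;> simp [hc', h]
  have hquot : ∀ j, θ j * (c' j)⁻¹ = if θ j = 0 then 0 else 1 := fun j => by
    by_cases h : θ j = 0 <;> simp [hc', h]
  obtain ⟨c'', β'', h''⟩ := jointFamily_map_torus V (fun _ => (1 : K)) c'
    (fun _ => one_ne_zero) hc'ne c β hJ
  let D : (Fin 4 × Fin 4 → K) →ₗ[K] (Fin 4 × Fin 4 → K) :=
    { toFun := fun y p => ((fun _ : Fin 4 => (1 : K)) p.1)⁻¹ * (c' p.2)⁻¹ * y p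
      map_add' := fun y z => by
        ext p; simp only [Pi.add_apply]; ring
      map_smul' := fun a y => by
        ext p; simp only [Pi.smul_apply, smul_eq_mul, RingHom.id_apply]; ring }
  have hDp : ∀ y p, D y p = (c' p.2)⁻¹ * y p := fun y p => by
    show ((fun _ : Fin 4 => (1 : K)) p.1)⁻¹ * (c' p.2)⁻¹ * y p = _
    simp
  let V' : Submodule K (Fin 4 × Fin 4 → K) := V.comap D
  have hfam : ∀ u : Fin 4 × Fin 4 → K, ∀ y ∈ V', ∃ e₀ e₁ : K, ∀ s : K,
      eval (u + s • y) (perPoly (Fin 4) K) = e₀ + s * e₁ + s ^ 2 * ∑ k, c'' k * (β'' k u y) ^ 2 :=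
    fun u y hy => h'' u y (Submodule.mem_comap.mp hy)
  have hmem : ∀ y : Fin 4 × Fin 4 → K, (∀ j, y (2, j) = 0) → (∀ j, y (3, j) = 0) → y (0, 3) = 0 →
      y (1, 3) = 0 → ∑ j, (if θ j = 0 then (0 : K) else 1) * y (1, j) = 0 → y ∈ V' := by
    intro y h2 h3 h03 h13 hs
    refine Submodule.mem_comap.mpr (hV _ (fun j => ?_) (fun j => ?_) ?_ ?_ ?_)
    · rw [hDp, h2, mul_zero]
    · rw [hDp, h3, mul_zero]
    · rw [hDp, h03, mul_zero]
    · rw [hDp, h13, mul_zero]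
    · have : ∑ j, θ j * D y (1, j) = ∑ j, (if θ j = 0 then (0 : K) else 1) * y (1, j) :=
        Finset.sum_congr rfl fun j _ => by rw [hDp, ← mul_assoc, hquot]
      rw [this]; exact hs
  rcases hS with ⟨h0, h1, h2⟩ | ⟨h0, h1, h2⟩ | ⟨h0, h1, h2⟩
  · -- `L = {v₂ = 0} ⊇ K^{01}`: ✓ p605861
    refine SymPencilPerFourRowPairNoJoint.not_jointFamily_four_of_row_pair V' ?_ ?_ c'' β'' hfam
    · apply hmem <;> simp [h0, h1, Fin.sum_univ_four]
    · apply hmem <;> simp [h0, h1, Fin.sum_univ_four]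
  · -- `L = {v₀ + v₁ = 0} = span{e₀−e₁, e₂}`: ✓ p606014
    refine SymPencilPerFourRowPairSkewNoJoint.not_jointFamily_four_of_row_pair_skew V' ?_ ?_
      c'' β'' hfam
    · apply hmem <;> simp [h0, h1, h2, Fin.sum_univ_four]
    · apply hmem <;> simp [h0, h1, h2, Fin.sum_univ_four]
  · -- `L = (1,1,1)^⊥`: ✓ p606066
    refine SymPencilPerFourRowPairSumNoJoint.not_jointFamily_four_of_row_pair_sum V' ?_ ?_
      c'' β'' hfam
    · apply hmem <;> simp [h0, h1, h2, Fin.sum_univ_four]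
    · apply hmem <;> simp [h0, h1, h2, Fin.sum_univ_four]

/-- **One normalisation step**: rows relabelled by `σ`, columns by `π.trans τ` (`π 3 = 3`), via
`jointFamily_map_prodCongr`; then `noJoint_of_rowNormal` with the weight vector `θ ∘ π`.
[folklore] -/
theorem torusDispatch_perm [CharZero K] {W : Submodule K (Fin 4 × Fin 4 → K)}
    {σ τ : Equiv.Perm (Fin 4)} {θ : Fin 4 → K}
    (hiff : ∀ x : Fin 4 × Fin 4 → K, x ∈ W ↔
      ((∀ j, x (σ 2, j) = 0) ∧ (∀ j, x (σ 3, j) = 0) ∧ x (σ 0, τ 3) = 0 ∧ x (σ 1, τ 3) = 0 ∧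
        ∑ j, θ j * x (σ 1, τ j) = 0))
    (π : Equiv.Perm (Fin 4)) (hπ : π 3 = 3)
    (hS : (θ (π 0) = 0 ∧ θ (π 1) = 0 ∧ θ (π 2) ≠ 0) ∨ (θ (π 0) ≠ 0 ∧ θ (π 1) ≠ 0 ∧ θ (π 2) = 0) ∨
      (θ (π 0) ≠ 0 ∧ θ (π 1) ≠ 0 ∧ θ (π 2) ≠ 0)) :
    ¬ HasJointFour W := by
  classical
  rintro ⟨cc, β, hJ⟩
  obtain ⟨c', β', h'⟩ := jointFamily_map_prodCongr W σ (π.trans τ) cc β hJ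
  refine noJoint_of_rowNormal _ (fun j => θ (π j)) (fun y h2 h3 h03 h13 hs => ?_) hS c' β' h'
  rw [show (LinearEquiv.funCongrLeft K K (Equiv.prodCongr σ (π.trans τ))).toLinearMap =
      ((LinearEquiv.funCongrLeft K K (Equiv.prodCongr σ (π.trans τ)) :
        (Fin 4 × Fin 4 → K) →ₗ[K] (Fin 4 × Fin 4 → K))) from rfl,
    Submodule.mem_map_equiv, hiff]
  have hπ3 : π.symm 3 = 3 := π.symm_apply_eq.mpr hπ.symm
  simp only [funCongrLeft_prodCongr_symm_apply, Equiv.symm_apply_apply, Equiv.symm_trans_apply,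
    hπ3]
  refine ⟨fun j => h2 _, fun j => h3 _, h03, h13, ?_⟩
  have : ∑ j, θ (π j) * y (1, j) = ∑ j, θ j * y (1, π.symm j) :=
    Fintype.sum_equiv π _ _ fun j => by simp only [Equiv.symm_apply_apply]
  rw [← this]; exact hs

/-- **Torus product types carry no joint family of four squares** — PLUMBING, PROVED (rev 2):
normalise by `prodCongr σ (π.trans τ)` with `π ∈ {1, (0 2), (1 2)}` chosen from the … (memo). [folklore] -/
theorem torusDispatch [CharZero K] :
    ∀ W : Submodule K (Fin 4 × Fin 4 → K), VTorusType W → ¬ HasJointFour W := by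
  classical
  rintro W ⟨σ, τ, θ, hθ3, hθ, hiff⟩
  have s020 : Equiv.swap (0 : Fin 4) 2 0 = 2 := by decide
  have s021 : Equiv.swap (0 : Fin 4) 2 1 = 1 := by decide
  have s022 : Equiv.swap (0 : Fin 4) 2 2 = 0 := by decide
  have s023 : Equiv.swap (0 : Fin 4) 2 3 = 3 := by decide
  have s120 : Equiv.swap (1 : Fin 4) 2 0 = 0 := by decide
  have s121 : Equiv.swap (1 : Fin 4) 2 1 = 2 := by decide
  have s122 : Equiv.swap (1 : Fin 4) 2 2 = 1 := by decide
  have s123 : Equiv.swap (1 : Fin 4) 2 3 = 3 := by decide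
  by_cases h0 : θ 0 = 0 <;> by_cases h1 : θ 1 = 0 <;> by_cases h2 : θ 2 = 0
  · -- empty support: contradicts `θ ≠ 0`
    exfalso; apply hθ; funext j
    rcases (by decide : ∀ j : Fin 4, j = 0 ∨ j = 1 ∨ j = 2 ∨ j = 3) j with rfl | rfl | rfl | rfl
    · exact h0
    · exact h1
    · exact h2
    · exact hθ3
  · -- supp = {2}
    exact torusDispatch_perm hiff (Equiv.refl _) rfl (Or.inl ⟨h0, h1, h2⟩)
  · -- supp = {1}: π = (1 2)
    refine torusDispatch_perm hiff (Equiv.swap 1 2) s123 (Or.inl ⟨?_, ?_, ?_⟩)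
    · rw [s120]; exact h0
    · rw [s121]; exact h2
    · rw [s122]; exact h1
  · -- supp = {1,2}: π = (0 2)
    refine torusDispatch_perm hiff (Equiv.swap 0 2) s023 (Or.inr (Or.inl ⟨?_, ?_, ?_⟩))
    · rw [s020]; exact h2
    · rw [s021]; exact h1
    · rw [s022]; exact h0
  · -- supp = {0}: π = (0 2)
    refine torusDispatch_perm hiff (Equiv.swap 0 2) s023 (Or.inl ⟨?_, ?_, ?_⟩)
    · rw [s020]; exact h2
    · rw [s021]; exact h1
    · rw [s022]; exact h0
  · -- supp = {0,2}: π = (1 2)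
    refine torusDispatch_perm hiff (Equiv.swap 1 2) s123 (Or.inr (Or.inl ⟨?_, ?_, ?_⟩))
    · rw [s120]; exact h0
    · rw [s121]; exact h2
    · rw [s122]; exact h1
  · -- supp = {0,1}
    exact torusDispatch_perm hiff (Equiv.refl _) rfl (Or.inr (Or.inl ⟨h0, h1, h2⟩))
  · -- supp = {0,1,2}
    exact torusDispatch_perm hiff (Equiv.refl _) rfl (Or.inr (Or.inr ⟨h0, h1, h2⟩))

end Summit.ValiantsHypothesis.ValiantsHypothesis.Theorems.SymPencilSingFiveClassification
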